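import Mathlib
import Summits.AtomisticToContinuum.HydrodynamicLimit.Theses.ImplosionDichotomy
import Summits.AtomisticToContinuum.HydrodynamicLimit.Theorems.ImplosionDichotomyDenseExcursionR2Modes
import Summits.AtomisticToContinuum.HydrodynamicLimit.Theorems.ImplosionDichotomyDenseExcursionR2WellPosedness
import Summits.AtomisticToContinuum.HydrodynamicLimit.Theorems.ImplosionDichotomyDenseExcursionR2EosData
import Summits.AtomisticToContinuum.HydrodynamicLimit.Theorems.ImplosionDichotomyHsEosLowDensity
import Summits.AtomisticToContinuum.HydrodynamicLimit.Theorems.ImplosionDichotomyDenseExcursionR2SelfSimilar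
import Summits.AtomisticToContinuum.HydrodynamicLimit.Theorems.ImplosionDichotomyDenseExcursionR2SelfSimilarCovariance
import Summits.AtomisticToContinuum.HydrodynamicLimit.Theorems.ImplosionDichotomyDenseExcursionR2RadialReduction
import Summits.AtomisticToContinuum.HydrodynamicLimit.Theorems.ImplosionDichotomyDenseExcursionR2IsentropicReduction
import Summits.AtomisticToContinuum.HydrodynamicLimit.Theorems.ImplosionDichotomyDenseExcursionR2LagrangeIdentity
import Summits.AtomisticToContinuum.HydrodynamicLimit.Theorems.ImplosionDichotomyDenseExcursionR2ExactSelfSimilar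
import Literature.Analysis.FluidPDE.CompressibleEulerImplosionMonatomicHolds
import Literature.Analysis.FluidPDE.CompressibleEulerLocalExistence
import Summits.AtomisticToContinuum.HydrodynamicLimit.Theorems.ImplosionDichotomyDenseExcursionR2Package
import Summits.AtomisticToContinuum.HydrodynamicLimit.Theorems.ImplosionDichotomyDenseExcursionConeLocality
import Summits.AtomisticToContinuum.HydrodynamicLimit.Theorems.ImplosionDichotomyDenseExcursionR2ChartReading
import Summits.AtomisticToContinuum.HydrodynamicLimit.Theorems.ImplosionDichotomyDenseExcursionR2RotationCovariance
import Summits.AtomisticToContinuum.HydrodynamicLimit.Theorems.ImplosionDichotomyDenseExcursionR2ShrinkingBallLocality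
import Summits.AtomisticToContinuum.HydrodynamicLimit.Theorems.ImplosionDichotomyDenseExcursionR2ExteriorAgreement
import Summits.AtomisticToContinuum.HydrodynamicLimit.Theorems.ImplosionDichotomyDenseExcursionR2EntropyTransportZ
import Summits.AtomisticToContinuum.HydrodynamicLimit.Theorems.ImplosionDichotomyDenseExcursionR2ScalingMode
import Summits.AtomisticToContinuum.HydrodynamicLimit.Theorems.ImplosionDichotomyDenseExcursionR2SlavingODE
import Summits.AtomisticToContinuum.HydrodynamicLimit.Theorems.ImplosionDichotomyDenseExcursionR2ExteriorDevelopment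

/-!
# Line `r2-one-mode-two-conditions` — skeleton v9 for crux `DenseExcursion` (stmt-AtomisticToContinuum-12586)

## v9 (lead c5, unit `line-…-12586-c5`, seat c5-0, 2026-08-16T21Z) — NO SIGNATURE CHANGE against v8g (registered stubs byte-identical:
`stub_profilePackage`, `stub_tunedForcedImplosion`; composition `DenseExcursion_of` unchanged). This lead's independent audit
(`Cruxes/DenseExcursion/NOTES-c5.md`): BOTH open stubs are UNPUBLISHED MATHEMATICS, not merely large — the `(1,2)` strip package of
`SS(r₂)` is a computer-assisted theorem nobody has certified (Biasi 2021's count is double-precision numerics; MRRS 2022 / BCG 2025 /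
CLGSS 2023 prove finite codimension abstractly, never the count, and no printed a-priori bound confines smooth radial point spectrum
to a compact set), and the heart is an unwritten σ-uniform FORCED finite-codimension stability theorem with two Melnikov conditions
for a non-polytropic pressure law (no printed implosion theorem treats any non-scale-invariant law, `Disproof.lean` §8.5). Neither
admits an honest worker-sized reshape (analysed in NOTES-c5.md §3); verdict of this cycle: `promote-stub` (heart; the package as its
co-promoted certified-numerics campaign). New dead ends recorded: the entropy-stratified profile family of NOTES-c4 §9 does not exist
as SMOOTH profiles (centre regularity forces local isentropy, `A = 0`); the cylindrical (`d = 2`, `x₃`-independent) variant of RACE is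
recorded as untried-with-reason: its sonic window closes at `r* = 2 − √3/2 = 1.1340` (`(d−1)W² − (2r+d−3)W + 3(r−1) = 0` on the sonic
line), so the packing clock is capped at `μ = 3(r*−1) = 0.402`, half the `d = 3` cap `0.804` under which RACE already failed.

## v8g (lead c4-0, end of cycle 1) — EIGHT BRICKS OF THE HEART LANDED in three waves (8 workers): chart reading p123856, rotation covariance
p123957, shrinking-ball locality p124057, exterior agreement p124201, entropy transport p124445, scaling mode p124524, slaving lemma p124596, exterior
development p124862; open: `stub_profilePackage` (certified numerics, WITH neutral strip) and the heart `stub_tunedForcedImplosion` (architecture in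
`Cruxes/DenseExcursion/NOTES-c4.md` = HEART BLUEPRINT).

## v8c (lead c4-0, 2026-08-16T21Z) — ALL FOUR LOCALITY BRICKS LANDED (wave 1, 4 workers, 4–12 min each): `stub_chartReading` p123856,
`stub_rotationCovariance` p123957, `stub_shrinkingBallLocality` p124057, `stub_exteriorAgreement` p124201 (their `def`s now importable from
`Theorems/…R2{ChartReading,RotationCovariance,ShrinkingBallLocality,ExteriorAgreement}.lean`, local copies deleted); the package carries the
NEUTRAL STRIP (`OneModeTwoConditionsStrip`, §0a; `strip_imp_package`); open: `stub_profilePackage` (certified numerics) and the heart.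
Lead numerics (`NUMERICS-c4.md`): `r₂ = 1.112816148628(3)`, CLGSS repulsivity hypotheses hold for `SS(r₂)` (radial margin 0.395, angular 0.648).

## v8 (lead c4, unit `line-…-12586-c4`, seat c4-0, 2026-08-16T20Z) — what changed against v7

* ∃-FORM OF THE SPECTRAL PACKAGE (`stub_profilePackage`, replaces the ∀-form `stub_spectralPackage` + the proved input
  `stub_profileEqs` on the composition path). The composition only ever needs the `(1,2)` package for ONE profile in the
  BCG window; the ∀-form additionally demanded a quantisation / phase-portrait theorem for EVERY globally smooth profile in
  the window (centre-regular solutions are unique up to scaling, cross the sonic line at `P₂` not `P₃`, `C^∞` through a node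
  with non-integer ratio forces an analytic branch, `e(r) ≠ 0` off `r₂`) — true numerically (cdisprove gen-4 audit,
  `Disproof.lean` §14 item 3, which itself recommends the ∃-form) but never used. The ∃-form is implied by the old pair, so
  anything landed against the ∀-form still serves. Its prover exhibits the BCG profile (`stub_profileEqs stub_bcgProfile`,
  PROVED) pinned to a tight speed window by two more high-precision right-barrier certificates and certifies the count there.
* THREE LOCALITY BRICKS OF THE HEART SPLIT OFF AS WORKER STUBS (honest parts of steps (A)/(B)/(G) of the heart's plan, needed
  by every architecture of the forced bootstrap; all over landed vocabulary, chart level = `AthermalEulerAt` of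
  `Theorems.KidderKnobMelnikov`, torus level = `IsHardSphereEulerSolution`):
  `stub_chartReading` (a classical hard-sphere solution of packing `< η₀` read in a chart `y ↦ x₀ + proj y` is a `C^∞`
  solution of the primitive athermal system with the smooth law `ζ(r) = Z(rσ³)` — the `σ > 0` twin of the landed
  `memberCore_chart_solves`), `stub_rotationCovariance` (the chart system is covariant under linear isometries — radiality of
  the core development), `stub_shrinkingBallLocality` (domain of dependence with a TIME-DEPENDENT speed bound `c(t)`, radius
  `R₀ − ∫₀ᵗ c`: the form needed up to the blow-up time, where physical speeds grow like `(T−t)^{1/r−1}`; from the landed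
  straight-cone `HsEulerConeLocality` by time-stepping and Riemann sums), `stub_exteriorAgreement` (two classical hard-sphere
  solutions on `𝕋³` with equal data off a chart ball agree off the ball fattened at the speed of the FIRST one — no a-priori
  hypothesis on the second: continuity induction in time over the landed cone locality; gives the exterior `C¹` bounds of the
  continuation argument via `stub_conditionalExistence` of the sibling crux). The heart takes the four statements as
  hypotheses (pattern of kidder v3), so its residue is exactly the forced self-similar bootstrap + tuning.
* HEART re-registered with the new hypotheses (name kept: `stub_tunedForcedImplosion`); `TunedPacking`,
  `OneModeTwoConditions`, `IsGeneralizedMode` are now the LANDED ones (`Theorems/…R2Package.lean`, p121667) — the local §0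
  copies of v7 are deleted; composition `DenseExcursion_of` unchanged in shape.


## v7 header (history)

Route `ImplosionDichotomy`, crux (rank 2)
`Summit.AtomisticToContinuum.HydrodynamicLimit.Theses.ImplosionDichotomy.DenseExcursion`:
there are `η > 0` and continuous positive profiles `(a₀, u₀, θ₀)` such that for every `σ₀ > 0` some
`σ ∈ (0, σ₀)` admits an ADMISSIBLE classical hard-sphere-Euler solution (its `t = 0` fields are the LLN
limit of the local Gibbs laws, for every flow family) whose packing `ρ σ³` reaches `η`.

## v7 (lead c3, unit `line-…-12586-c3`, seat c3-0, 2026-08-16T19Z) — what changed against v6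

* SIX STUBS WIRED (sorries 8 → 2). The two LITERATURE INPUTS became theorems of the tree today and are wired in:
  `stub_bcgProfile := BuckmasterCaolaboraGomezserrano2025_thm11_monatomic_holds` (BCG 2025 Thm 1.1 at `γ = 5/3` from the 32
  kernel-certified Taylor-model windows `CompressibleEulerImplosionLeftTMW0..31`, Literature theorem since 18:43Z) and
  `stub_majdaLWP := CompressibleEulerLocalWellPosedness_holds` (Majda 1984 Thms 2.1–2.2 on the tree's quasilinear
  symmetric-hyperbolic local existence on `𝕋³`, `Literature/Analysis/FluidPDE/CompressibleEulerLocalExistence.lean`).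
  The four LANDED bridges of v5/v6 are wired by `exact` (their oleans are built): `stub_lagrangeIdentity` (p107728),
  `stub_exactSelfSimilar` (p112231), `stub_radialReduction` (p106459), `stub_isentropicReduction` (p105814); the local
  copies of `adjW/adjS/lagrangeForm/LagrangeIdentity/ExactSelfSimilar` are deleted in favour of the landed ones
  (`Theorems.R2OneModeTwoConditions.*`, same text).
* HEART RESHAPED (honestly smaller, same composition): (a) clause (i) of the old `TunedImplosion` — "the ideal development
  of the tuned datum `ImplodesWithProfile r W S`" — is DROPPED: the composition never read it (v6 discarded it with `-`),
  and as typed it is FALSE for a Kidder-sheared datum (member `b ≠ 0` implodes with the TRANSLATED profile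
  `W(· + log c_b), S(· + log c_b)`, `c_b = (1 + bT)^{1 - 2/r}`, not with `(W, S)`), so it only burdened the heart; (b) the
  conclusion is now LITERALLY the right-hand side of the landed `denseExcursion_iff_eosData` (`TunedPacking`: sequence form
  `∀ σ₀ ∃ σ < σ₀`, `∃ n, EosRelated σ a₀ n`, classical hard-sphere solution from `(n, u₀, θ₀)` reaching packing `η`) — the
  flow-free crux itself, so the heart is exactly "a profile in the BCG window with the `(1,2)` package ⇒ the crux (EOS
  form)", neither weaker nor stronger than needed; (c) the four hypotheses that are THEOREMS now (`HsEosLowDensity`,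
  `HsEulerWellPosedness`, `LagrangeIdentity`, `ExactSelfSimilar`) are dropped from the signature and listed under
  "Leans on" (the prover imports them); the BCG window `11/10 < r < 227/200` and the original-form profile equations are
  ADDED as hypotheses (the heart's weighted estimates need profile-specific certified inequalities that hold for THE
  window profile only; both are in hand in the composition). Registered name kept: `stub_tunedForcedImplosion`.
* `stub_spectralPackage`: signature byte-identical to v4/v6 (registered, cdisprove gen-4 audit "safe").

## v5/v6 (parallel lead, unit `line-…-12586-c1`, seat c1-0, 2026-08-16) — what changed against v1–v4

* VOCABULARY IS IMPORTED, NOT RE-POSITED. Everything the earlier r2 seats landed is used through its tree module: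
  `IsMonatomicProfile`, `linW/linS`, `IsRegularPair`, `IsSmoothRadialMode`, `stub_profileEqs`,
  `gauge_isSmoothRadialMode` (`…R2Modes`, p85367; `…R2Profile`, p82476), `HsEulerWellPosedness`,
  `stub_wellPosedness_of` (`…R2WellPosedness`, p85424), `excessChemicalPotential`, `EosRelated`,
  `stub_admissibleData` (`…R2AdmissibleData`, p78023), `eosRelated_rhoLim`, `eosRelated_unique`,
  `denseExcursion_iff_eosData` (`…R2EosData`, p85012). Only the four NOT-yet-landed notions are defined here
  (§0: `IsGeneralizedMode`, `OneModeTwoConditions`, `ImplodesWithProfile`, `TunedImplosion`, verbatim v1/v4 text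
  over the imported names), so every registered signature below elaborates against the tree.
* THE COMPOSITION IS UNCONDITIONAL: `HsEosLowDensity` (stmt-0768) is discharged by the tree theorem
  `Theorems.hsEosLowDensity_proof` (p75216), and the particle side of the crux is discharged by the landed
  equivalence `denseExcursion_iff_eosData` (the crux IS the flow-free statement "the classical hard-sphere-Euler
  solution from THE local-equilibrium density of `a₀` reaches packing `η` along a sequence `σ → 0`"), so the old
  statics stub is no longer on the path (it stays landed and is re-exported for the disprover).
* WAVE 1 LANDED (v5c): the §0b definitions module (p98448, with `stub_linearisation` proved), W1
  `stub_selfSimilarCovariance` (p101028), W2 `stub_isentropicReduction` (p105814), W4 `stub_radialReduction` (RESHAPED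
  after a kernel-checked `stub-misstated`: + `DifferentiableAt ℝ D z.1`; p106459) — the typed bridge from the hard-sphere
  system to the r2 spectral vocabulary. v6 adds §0c: jet-level forced right-hand sides with the SECOND-VIRIAL TRUNCATION (`rhs_affine`, proved: the first-order
  forcing `F₁ = (0, 2tf(pf+pf′)+tf′pf, pf tf(2w+(2/3)w′))` per unit `Bδ`), ENTROPY TRANSPORT at jet level (`entropy_transport_jet`, proved),
  the formal adjoint `(adjW, adjS)` with the LAGRANGE IDENTITY (`stub_lagrangeIdentity`, N4, worker) and the exact self-similar member
  (`stub_exactSelfSimilar`, N1, worker) — the typed road to `K₁ = ⟨w₁, F₁⟩`. OPEN OBLIGATIONS (6 sorries): N1, N4 (wave 2); two LITERATURE INPUTS — `stub_bcgProfile` (BCG 2025 Thm 1.1 at `γ = 5/3`; being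
  discharged brick by brick in `Literature/Analysis/FluidPDE/CompressibleEulerImplosion*.lean`) and `stub_majdaLWP`
  (Majda 1984 Thms 2.1–2.2, the named fact `CompressibleEulerLocalWellPosedness`); one CERTIFIED-NUMERICS input —
  `stub_spectralPackage` (the `(m, J) = (1, 2)` package of `SS(r₂)`; registered ∀-form of v4 with the original-form
  profile equations as hypothesis, cdisprove gen-4 audit "safe"); and the HEART `stub_tunedForcedImplosion`
  (registered v3/v4 signature; held by the lead).

## The line (idea card `Ideas/r2-one-mode-two-conditions.md`, triage r1-1/2/3: pass)

Target the FIRST globally smooth self-similar implosion profile `SS(r₂)` of the monatomic gas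
(`γ = 5/3`, `(d, ℓ) = (3, 3)`, `r₂ ≈ 1.1128162`). Its computed radial smooth-mode spectrum has exactly
ONE genuine unstable mode `Λ₁ ≈ 0.79711` against the packing clock `μ = 3(r₂ - 1) ≈ 0.33845`; since
`2μ < Λ₁ < 3μ`, a `σ`-INDEPENDENT profile reaches packing `η` iff the `σ³`- and `σ⁶`-coefficients
`K₁, K₂` of the unstable projection vanish: `(m, J) = (1, 2)`. Equivalent dynamical picture (lead c1, NOTES):
after the self-similar rescaling the hard-sphere problem from exactly self-similar data at diameter `σ` is ONE
non-autonomous trajectory problem started at the profile at clock time `τ₀ = μ⁻¹ log σ³ → -∞`; the tracked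
solution is the unique ANCIENT trajectory `X_* = SS + e^{μτ}Y₁ + e^{2μτ}Y₂ + …`, `Y_k = (kμ - L)⁻¹(…)`
(`kμ ∉ spec L`), and `K₁, K₂` are the unstable coordinates of `SS - X_*(τ₀)` at orders `σ³, σ⁶`; both must
vanish EXACTLY because they are amplified by `σ^{-3Λ₁/μ} = σ^{-7.07}` before packing `η`, while the `σ⁹` term is
slaved (`3μ > Λ₁`). Numbers on record (three seats, two methods): `K₁` has one transversal zero on the Kidder
knob, `b₀T = -0.4234`; `K₂(b₀)/k_H = -0.380 ± 0.005` (perturbative) resp. `G₂ = +0.095 ± 0.008` (direct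
simulation): the once-tuned knob member misses the second condition, so the second parameter must come from the
stable manifold `W^s(SS(r₂))` — the open decision number is the sign of `K₂` along `Z₁ = {K₁ = 0} ∩ W^s`.

Conventions (derived by hand by the planner, checked by three seats): radial velocity `u = -R W /(r (T - t))`,
sound speed `c = R S /(r (T - t))`, `y = R (T - t)^{-1/r}`, `x = log y`, clock `T - t = T e^{-r τ}`; then
`Δ W' = -Δ₁`, `Δ S' = -Δ₂` with `Δ = (1 - W)² - S²` (Biasi 2021 §2, Merle–Raphaël–Rodnianski–Szeftel),
centre `x → -∞` at `(S, W) = (∞, r - 1)`, far field `x → +∞` at `(0, 0)`; ideal monatomic gas `c² = (5/3) θ`.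
-/

noncomputable section

open Filter Set MeasureTheory
open scoped Topology ContDiff

namespace Summit.AtomisticToContinuum.HydrodynamicLimit.Cruxes.DenseExcursion.R2OneModeTwoConditions

open Literature.MathematicalPhysics.KineticTheory
open Summit.AtomisticToContinuum.HydrodynamicLimit.Theses.ImplosionDichotomy
open Summit.AtomisticToContinuum.HydrodynamicLimit.Theorems.R2OneModeTwoConditions
open Summit.AtomisticToContinuum.HydrodynamicLimit.Theorems.KidderKnobMelnikov (AthermalEulerAt)
open Literature.Analysis.FunctionSpaces (Torus.proj)

/-! ### §0 (v8) The three line notions `IsGeneralizedMode`, `OneModeTwoConditions`, `TunedPacking` are the LANDED ones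
(`Theorems/ImplosionDichotomyDenseExcursionR2Package.lean`, p121667, namespace `…Theorems.R2OneModeTwoConditions`, opened
below); `tunedPacking_iff_denseExcursion : TunedPacking ↔ DenseExcursion` likewise. Nothing is re-posited. -/

/-! ### §0a (NEW in v8c) The package WITH THE NEUTRAL STRIP

The heart's bootstrap needs decay on the complement of the unstable/symmetry directions, i.e. NO smooth radial point spectrum in a strip
`−δ₀ < Re Λ ≤ 0` besides the scaling symmetry mode `Λ = 0` (`(W′, S′)`, certified identity `linW_translation_mode` of `Disproof.lean` §12),
itself without a Jordan partner. Numerics (c3-0 `SpectrumC3.md`, strip scan): the smooth radial point spectrum with `Re Λ ∈ [−1.2, 1.25]`,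
`|Im Λ| ≤ 60` is `{−1.1128, −0.6014, −0.3172, 0, 0.7971, 1.1128}`, all real and simple — so any `δ₀ < 0.3172` works and costs the
certification nothing extra (same argument principle on a slightly larger contour). `OneModeTwoConditionsStrip → OneModeTwoConditions`
(`strip_imp_package`, proved below), so everything stated against the landed package still applies. -/

/-- THE `(1, 2)` PACKAGE WITH THE NEUTRAL STRIP (v8c): `OneModeTwoConditions` (landed, `…R2Package.lean`) with the exclusivity clause
extended from `Re Λ > 0` to a strip `Re Λ > −δ₀`, `δ₀ > 0`, where the only extra smooth radial mode is the scaling symmetry mode `Λ = 0`,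
which is simple: every smooth mode at `0` is a multiple of `(W′, S′)` and `(W′, S′)` has no generalised (Jordan) partner. -/
def OneModeTwoConditionsStrip (r : ℝ) (W S : ℝ → ℝ) : Prop :=
  IsMonatomicProfile r W S ∧
  ∃ Λ₁ δ₀ : ℝ, 6 * (r - 1) < Λ₁ ∧ Λ₁ < 9 * (r - 1) ∧ 0 < δ₀ ∧
    (∃ ŵ ŝ : ℝ → ℂ, IsSmoothRadialMode r W S (Λ₁ : ℂ) ŵ ŝ) ∧
    (∀ ŵ₁ ŝ₁ : ℝ → ℂ, IsSmoothRadialMode r W S (Λ₁ : ℂ) ŵ₁ ŝ₁ →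
      ∀ ŵ₂ ŝ₂ : ℝ → ℂ, ¬ IsGeneralizedMode r W S (Λ₁ : ℂ) ŵ₁ ŝ₁ ŵ₂ ŝ₂) ∧
    (∀ Λ : ℂ, -δ₀ < Λ.re → (∃ ŵ ŝ : ℝ → ℂ, IsSmoothRadialMode r W S Λ ŵ ŝ) →
      Λ = (Λ₁ : ℂ) ∨ Λ = (r : ℂ) ∨ Λ = 0) ∧
    (∀ ŵ ŝ : ℝ → ℂ, IsSmoothRadialMode r W S 0 ŵ ŝ →
      ∃ c : ℂ, ∀ x, ŵ x = c * ((deriv W x : ℝ) : ℂ) ∧ ŝ x = c * ((deriv S x : ℝ) : ℂ)) ∧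
    (∀ ŵ₂ ŝ₂ : ℝ → ℂ,
      ¬ IsGeneralizedMode r W S 0 (fun x => ((deriv W x : ℝ) : ℂ)) (fun x => ((deriv S x : ℝ) : ℂ)) ŵ₂ ŝ₂)

/-- The strip package implies the landed package (drop the strip to `Re Λ > 0`, where `Λ = 0` is excluded). -/
theorem strip_imp_package {r : ℝ} {W S : ℝ → ℝ} (h : OneModeTwoConditionsStrip r W S) :
    OneModeTwoConditions r W S := by
  obtain ⟨hP, Λ₁, δ₀, h6, h9, hδ, hmode, hsimple, hstrip, -, -⟩ := h
  refine ⟨hP, Λ₁, h6, h9, hmode, hsimple, fun Λ hΛ hex => ?_⟩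
  rcases hstrip Λ (by linarith) hex with h1 | h2 | h3
  · exact Or.inl h1
  · exact Or.inr h2
  · exact absurd hΛ (by rw [h3]; simp)

/-! ### §0b Self-similar variables of the hard-sphere system (NEW in v5; worker stubs W1, W2, W4 below)

The heart's analysis (forced modulation around `SS(r)`) is carried out in dynamical self-similar variables. This
block types that change of variables at the same pointwise `fderiv` level as the sibling line's landed
`EulerZAt` / `ProjectiveCovariance` (`Theorems.KidderKnobMelnikov`, p72839), so that one chain-rule proof makes the
r2 spectral vocabulary (`linW`, `linS`, `IsSmoothRadialMode`, posited by hand by the planner) a KERNEL-CHECKED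
linearisation of the actual hard-sphere Euler system. Conventions (lead c1, NOTES.md §SelfSimilar, derived by hand
and cross-checked against the landed original-form profile equations): time-to-collapse `s = T e^{-rτ}`,
`t = T - s`, `x = x₀ + s^{1/r} ζ`; `ρ = s^{-(3-3/r)} 𝒫`, `u = r⁻¹ s^{1/r-1} 𝒱`, `θ = r⁻² s^{2/r-2} Θ̂`; every power
`s^a` is written `T^a e^{-raτ}` so that only `Real.exp` is ever differentiated. Then the physical system
`EulerZAt σ h Z` at `(t, x)` is, up to the positive factors `r s^{4-3/r}`, `r² s^{5-4/r}`, `r³ s^{3-2/r}`, the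
SELF-SIMILAR system `SelfSimEulerZAt r D H Z` at `(τ, ζ)` with the exponentially GROWING diameter
`D(τ) = σ s^{1/r-1}` (packing `𝒫 D³ = ρ σ³` is invariant) and heating `H(τ) = r s h(t)`:
`∂_τ𝒫 + ∇·(𝒫(𝒱 + ζ)) + (3r-6)𝒫 = 0`, `𝒫(∂_τ𝒱 + (r-1)𝒱 + ((ζ+𝒱)·∇)𝒱) + ∇(𝒫 Θ̂ Z(𝒫D³)) = 0`,
`∂_τΘ̂ + 2(r-1)Θ̂ + (ζ+𝒱)·∇Θ̂ + (2/3)Θ̂ Z ∇·𝒱 = H Θ̂ (Z-1)`. Radial fields `𝒫 = pf(τ, log‖ζ‖)`,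
`𝒱 = -w(τ, log‖ζ‖) ζ`, `Θ̂ = ‖ζ‖² tf(τ, log‖ζ‖)` reduce it to three scalar equations in `(pf, w, tf)(τ, x)`
(`RadialReduction`), and the isentropic ideal ansatz `𝒫 = C‖ζ‖³sf³`, `Θ̂ = (3/5)‖ζ‖²sf²` to the planner's
`w_τ = (w-1)w' + 3sfsf' + w² - rw + 3sf²`, `sf_τ = (w-1)sf' + (sf/3)w' + sf(2w-r)` (`IsentropicReduction`), whose
steady states are exactly the landed original-form profile equations of `stub_profileEqs` and whose linearisation
is exactly `(linW, linS)` (`linearisation_hasDerivAt`, proved here). -/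

-- (v5c) All §0b definitions (`ssMap`, `ssDensity`, `ssVelocity`, `ssTemperature`, `SelfSimEulerZAt`,
-- `SelfSimilarCovariance`, `dτ`, `dx`, `logPt`, `radDensity`, `radVelocity`, `radTemperature`, `RadialReduction`,
-- `isenDensity`, `isenTemperature`, `IsentropicReduction`) LANDED in the shared module
-- `Theorems/ImplosionDichotomyDenseExcursionR2SelfSimilar.lean` (p98448) and are used from there (namespace
-- `…Theorems.R2OneModeTwoConditions`, opened above); nothing is re-posited here.

/-- The r2 spectral vocabulary IS the linearisation of the isentropic self-similar system (LANDED as the registered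
stub `Theorems.R2OneModeTwoConditions.stub_linearisation`, p98448): the `ε`-derivatives at `0` of the two right-hand
sides of `IsentropicReduction` along a jet perturbation are `linW`, `linS`. -/
theorem linearisation_hasDerivAt (r : ℝ) (W S : ℝ → ℝ) (ŵ ŝ : ℝ → ℂ) (x : ℝ) :
    HasDerivAt (fun ε : ℂ =>
        ((W x : ℂ) + ε * ŵ x - 1) * (((deriv W x : ℝ) : ℂ) + ε * deriv ŵ x) +
          3 * ((S x : ℂ) + ε * ŝ x) * (((deriv S x : ℝ) : ℂ) + ε * deriv ŝ x) +
          ((W x : ℂ) + ε * ŵ x) ^ 2 - r * ((W x : ℂ) + ε * ŵ x) + 3 * ((S x : ℂ) + ε * ŝ x) ^ 2)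
      (linW r W S ŵ ŝ x) 0 ∧
    HasDerivAt (fun ε : ℂ =>
        ((W x : ℂ) + ε * ŵ x - 1) * (((deriv S x : ℝ) : ℂ) + ε * deriv ŝ x) +
          ((S x : ℂ) + ε * ŝ x) / 3 * (((deriv W x : ℝ) : ℂ) + ε * deriv ŵ x) +
          ((S x : ℂ) + ε * ŝ x) * (2 * ((W x : ℂ) + ε * ŵ x) - r))
      (linS r W S ŵ ŝ x) 0 :=
  Theorems.R2OneModeTwoConditions.stub_linearisation r W S ŵ ŝ x

/-- The CORRECTED radial reduction statement (reshape after worker W4's kernel-checked `stub-misstated`: the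
line-posited `RadialReduction` of the defs module quantifies over ALL diameters `D : ℝ → ℝ` and is FALSE for a `D`
not differentiable at `τ` — `fderiv` junk makes the self-similar momentum equation hold trivially; the fix is the
single extra hypothesis `DifferentiableAt ℝ D z.1`, all right-hand sides unchanged and now verified in Lean). -/
def RadialReductionD : Prop :=
  ∀ (r : ℝ) (D H Z : ℝ → ℝ) (pf w tf : ℝ × ℝ → ℝ) (z : ℝ × V3), z.2 ≠ 0 →
    DifferentiableAt ℝ pf (logPt z) → DifferentiableAt ℝ w (logPt z) → DifferentiableAt ℝ tf (logPt z) →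
    0 < pf (logPt z) → DifferentiableAt ℝ D z.1 → DifferentiableAt ℝ Z (pf (logPt z) * D z.1 ^ 3) →
    (SelfSimEulerZAt r D H Z (radDensity pf) (radTemperature tf) (radVelocity w) z ↔
      (dτ pf (logPt z) = (w (logPt z) - 1) * dx pf (logPt z) +
          pf (logPt z) * (dx w (logPt z) + 3 * w (logPt z) + 3 - 3 * r) ∧
       dτ w (logPt z) = (w (logPt z) - 1) * dx w (logPt z) + w (logPt z) ^ 2 - r * w (logPt z) +
          (2 * tf (logPt z) + tf (logPt z) * dx pf (logPt z) / pf (logPt z) + dx tf (logPt z)) *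
              Z (pf (logPt z) * D z.1 ^ 3) +
            tf (logPt z) * deriv Z (pf (logPt z) * D z.1 ^ 3) * (dx pf (logPt z) * D z.1 ^ 3) ∧
       dτ tf (logPt z) = (w (logPt z) - 1) * dx tf (logPt z) +
          2 / 3 * Z (pf (logPt z) * D z.1 ^ 3) * tf (logPt z) * dx w (logPt z) +
          tf (logPt z) * (2 * w (logPt z) - 2 * r + 2 * w (logPt z) * Z (pf (logPt z) * D z.1 ^ 3)) +
          H z.1 * (Z (pf (logPt z) * D z.1 ^ 3) - 1) * tf (logPt z)))

/-! ### §0c-1 Jet-level right-hand sides of the forced radial system and the SECOND-VIRIAL TRUNCATION (N3) -/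

/-- `w`-component of the forced radial right-hand side of `RadialReduction` at the jet `(pf, pf', w, w', tf, tf')`,
equation of state `Z`, packing scale `δ = D³`, no heating: `(w-1)w' + w² - rw + (2tf + tf pf'/pf + tf') Z(pf δ) + tf Z'(pf δ) pf' δ`. -/
def rhsW (r : ℝ) (Z : ℝ → ℝ) (δ pf pf' w w' tf tf' : ℝ) : ℝ :=
  (w - 1) * w' + w ^ 2 - r * w + (2 * tf + tf * pf' / pf + tf') * Z (pf * δ) + tf * deriv Z (pf * δ) * (pf' * δ)

/-- `tf`-component: `(w-1)tf' + (2/3) Z tf w' + tf (2w - 2r + 2w Z)` (no heating). -/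
def rhsT (r : ℝ) (Z : ℝ → ℝ) (δ pf w w' tf tf' : ℝ) : ℝ :=
  (w - 1) * tf' + 2 / 3 * Z (pf * δ) * tf * w' + tf * (2 * w - 2 * r + 2 * w * Z (pf * δ))

/-- FIRST-ORDER (virial) FORCING of the `w`-equation per unit `B δ`: `2 tf (pf + pf') + tf' pf`
(virial pressure gradient `∇(Bρ²θ)/ρ` in self-similar radial variables). -/
def forceW (pf pf' tf tf' : ℝ) : ℝ := 2 * tf * (pf + pf') + tf' * pf

/-- FIRST-ORDER FORCING of the `tf`-equation per unit `B δ`: `pf tf (2w + (2/3) w')` (excess compression work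
`(2/3)θ(Z-1)∇·u`). -/
def forceT (pf w w' tf : ℝ) : ℝ := pf * tf * (2 * w + 2 / 3 * w')

/-- SECOND-VIRIAL TRUNCATION IS EXACT AT FIRST ORDER: for the affine equation of state `Z(η) = 1 + Bη` the forced
right-hand sides are EXACTLY the ideal ones plus `δ B ·` the first-order forcings (no remainder), `pf ≠ 0`. -/
theorem rhs_affine (r B δ pf pf' w w' tf tf' : ℝ) (hpf : pf ≠ 0) :
    rhsW r (fun η => 1 + B * η) δ pf pf' w w' tf tf' =
        rhsW r (fun _ => 1) 0 pf pf' w w' tf tf' + δ * B * forceW pf pf' tf tf' ∧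
      rhsT r (fun η => 1 + B * η) δ pf w w' tf tf' =
        rhsT r (fun _ => 1) 0 pf w w' tf tf' + δ * B * forceT pf w w' tf := by
  have hd : ∀ y, deriv (fun η : ℝ => 1 + B * η) y = B := fun y => by
    simp [deriv_const_add]
  have hd0 : ∀ y, deriv (fun _ : ℝ => (1 : ℝ)) y = 0 := fun y => by simp
  constructor
  · simp only [rhsW, forceW, hd, hd0]
    field_simp
    ring
  · simp only [rhsT, forceT]
    ring

/-! ### §0c-2 Formal adjoint, LAGRANGE IDENTITY (N4) and the exact self-similar member (N1) — LANDED

v7: the v6-local definitions `adjW`, `adjS`, `lagrangeForm`, `LagrangeIdentity` (N4) and `ExactSelfSimilar` (N1) are the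
LANDED ones of `Theorems/ImplosionDichotomyDenseExcursionR2LagrangeIdentity.lean` (p107728) and
`Theorems/ImplosionDichotomyDenseExcursionR2ExactSelfSimilar.lean` (p112231) (namespace `…Theorems.R2OneModeTwoConditions`,
opened above; byte-identical text), used by import — nothing re-posited. -/

/-- ENTROPY TRANSPORT at jet level: for the ideal radial self-similar system (`Z ≡ 1`, the `pf`- and `tf`-equations of
`RadialReduction`), the entropy variable `κ = log tf - (2/3) log pf + 2x` is purely TRANSPORTED, `κ_τ = (w-1) κ_x`; written
without logarithms: `pf tf_τ - (2/3) tf pf_τ = (w-1)(pf tf' - (2/3) tf pf' + 2 pf tf)`. Consequently the linearisation around an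
isentropic profile is block-triangular (entropy modes `Λ = -2k(2-r) ≤ 0`, acoustic block `(linW, linS)`), so the unstable smooth
radial spectrum of the FULL system is that of `OneModeTwoConditions`. [folklore] -/
theorem entropy_transport_jet (r pf pf' pfτ w w' tf tf' tfτ : ℝ)
    (hpf : pfτ = (w - 1) * pf' + pf * (w' + 3 * w + 3 - 3 * r))
    (htf : tfτ = (w - 1) * tf' + 2 / 3 * 1 * tf * w' + tf * (2 * w - 2 * r + 2 * w * 1)) :
    pf * tfτ - 2 / 3 * tf * pfτ = (w - 1) * (pf * tf' - 2 / 3 * tf * pf' + 2 * pf * tf) := by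
  rw [hpf, htf]
  ring

/-- STUB N4 (v6, size M) — LANDED (p107728, `Theorems.R2OneModeTwoConditions.stub_lagrangeIdentity`), wired v7: the pointwise
LAGRANGE IDENTITY of the radial linearised operator `(linW, linS)` with its formal adjoint `(adjW, adjS)` and boundary form
`lagrangeForm`. -/
theorem stub_lagrangeIdentity : LagrangeIdentity :=
  Theorems.R2OneModeTwoConditions.stub_lagrangeIdentity

/-- STUB N1 (v6, size M−) — LANDED (p112231, `Theorems.R2OneModeTwoConditions.stub_exactSelfSimilar`), wired v7: a monatomic
profile with its original-form equations is a STEADY solution of the ideal self-similar system in r2 variables. -/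
theorem stub_exactSelfSimilar : ExactSelfSimilar :=
  Theorems.R2OneModeTwoConditions.stub_exactSelfSimilar

/-! ### §0d (NEW in v8) Locality vocabulary of the heart's continuation argument — four worker stubs, ALL LANDED (v8b: p123856, p123957, p124057, p124201)

Conventions. Chart at `x₀ ∈ 𝕋³`: `y ↦ x₀ + Torus.proj y`, fields read in the chart are curried maps `ℝ → V3 → _`
exactly as in `Theorems.KidderKnobMelnikov.AthermalEulerAt` / `HsEulerConeLocality` / `memberCore_chart_solves` (landed,
`…ConeDefs.lean`, `…ConeLocality.lean`, `…MemberCoreChart.lean`). The smooth equation of state `Z` with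
`hsCompressibility = Z` on `[0, η₀]` exists for every `η₀` below the analyticity threshold
(`Theorems.R2OneModeTwoConditions.exists_smooth_compressibility_Icc`, landed), so every hypothesis below is inhabited. -/

-- (v8b) `HsChartReading` is the LANDED definition of `Theorems/ImplosionDichotomyDenseExcursionR2ChartReading.lean`
-- (p123856, worker L1 of lead c4-0, namespace `…Theorems.R2OneModeTwoConditions`, opened above); not re-posited.

-- (v8b) `ChartRotationCovariance` is the LANDED definition of `Theorems/ImplosionDichotomyDenseExcursionR2RotationCovariance.lean`
-- (p123957, worker L2 of lead c4-0); not re-posited.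

-- (v8b) `ShrinkingBallLocality` is the LANDED definition of `Theorems/ImplosionDichotomyDenseExcursionR2ShrinkingBallLocality.lean`
-- (p124057, worker L3 of lead c4-0); not re-posited.

-- (v8b) `ExteriorAgreement` is the LANDED definition of `Theorems/ImplosionDichotomyDenseExcursionR2ExteriorAgreement.lean`
-- (p124201, worker L4 of lead c4-0); not re-posited.

/-! ### §0e (NEW in v8d) Three more bricks of the heart (wave 2): the scaling symmetry mode as a typed smooth mode, the
slaving lemma above the resonance (`3μ > Λ₁`: the unstable seed of order `ε₀³` never catches up with the packing), and exact
ENTROPY TRANSPORT for the hard-sphere law at jet level (the entropy sector decouples from the acoustic block for every `Z`). -/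

-- (v8e) `ScalingMode` is the LANDED definition of `Theorems/ImplosionDichotomyDenseExcursionR2ScalingMode.lean`
-- (p124524, worker M1 of lead c4-0); not re-posited.

-- (v8f) `SlavingODE` is the LANDED definition of `Theorems/ImplosionDichotomyDenseExcursionR2SlavingODE.lean`
-- (p124596, worker M2 of lead c4-0); not re-posited.

-- (v8e) `EntropyTransportZ` is the LANDED definition of `Theorems/ImplosionDichotomyDenseExcursionR2EntropyTransportZ.lean`
-- (p124445, worker M3 of lead c4-0); not re-posited.

/-! ### §0f (NEW in v8e) The exterior development exists up to the blow-up time, uniformly in σ (wave 3)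

Blueprint §7 (B)/(G): `ExteriorAgreement` compares the unknown solution with an EXTERIOR DEVELOPMENT `τ^σ` — the hard-sphere development of
data that coincide with the pinned data off the core ball and are a smooth ISENTROPIC filler inside. Its existence on a σ-INDEPENDENT
horizon is an assembly of two landed theorems of the sibling crux `PolynomialCompression`: the polynomial-loss shadowing a-priori bounds
`stub_logBudgetShadowing` (reference = any classical isentropic ideal solution on `[0, T₁)`, here restricted to a compact sub-horizon where
its Type-I / polynomial / floor hypotheses hold trivially) and conditional existence `stub_conditionalExistence` (Kato–Majda, landed
`…PolynomialCompressionConditionalExistence.lean`), with the equation-of-state inputs of `hsEosLowDensity_proof`. -/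

-- (v8g) `ExteriorDevelopment` is the LANDED definition of `Theorems/ImplosionDichotomyDenseExcursionR2ExteriorDevelopment.lean`
-- (p124862, worker M4 of lead c4-0); not re-posited.

/-! ### §1 The stubs (registered; `sorry` only in the open ones) -/

/-- STUB (LITERATURE INPUT) — DISCHARGED BY THE TREE (v7): the Buckmaster–Cao-Labora–Gómez-Serrano profile theorem at
`γ = 5/3`, `Literature.Analysis.FluidPDE.BuckmasterCaolaboraGomezserrano2025_thm11_monatomic_holds`
(`CompressibleEulerImplosionMonatomicHolds.lean`: shooting argument on the 32 kernel-certified Taylor-model windows). -/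
theorem stub_bcgProfile : Literature.Analysis.FluidPDE.BuckmasterCaolaboraGomezserrano2025_thm11_monatomic :=
  Literature.Analysis.FluidPDE.BuckmasterCaolaboraGomezserrano2025_thm11_monatomic_holds

/-- STUB (LITERATURE INPUT) — DISCHARGED BY THE TREE (v7): Majda 1984 Thms 2.1–2.2,
`Literature.Analysis.FluidPDE.CompressibleEulerLocalWellPosedness_holds`. -/
theorem stub_majdaLWP : Literature.Analysis.FluidPDE.CompressibleEulerLocalWellPosedness :=
  Literature.Analysis.FluidPDE.CompressibleEulerLocalWellPosedness_holds

/-- STUB (LANDED, p85367): the smooth profile in the BCG window with its two profile equations in ORIGINAL form. -/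
theorem stub_profileEqs :
    Literature.Analysis.FluidPDE.BuckmasterCaolaboraGomezserrano2025_thm11_monatomic →
    ∃ (r : ℝ) (W S : ℝ → ℝ), (11 / 10 < r ∧ r < 227 / 200) ∧ IsMonatomicProfile r W S ∧
      ∀ x, (W x - 1) * deriv W x + 3 * S x * deriv S x = r * W x - W x ^ 2 - 3 * S x ^ 2 ∧
        (1 - W x) * deriv S x - S x / 3 * deriv W x = S x * (2 * W x - r) :=
  Theorems.R2OneModeTwoConditions.stub_profileEqs

/-- STUB (LANDED, p85424) + v7 discharge: hard-sphere local well-posedness with `C¹` continuation below the EOS threshold. -/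
theorem stub_wellPosedness_of :
    Literature.Analysis.FluidPDE.CompressibleEulerLocalWellPosedness → HsEulerWellPosedness :=
  Theorems.R2OneModeTwoConditions.stub_wellPosedness_of

/-- `HsEulerWellPosedness` holds (v7). -/
theorem hsEulerWellPosedness : HsEulerWellPosedness :=
  stub_wellPosedness_of stub_majdaLWP

/-- STUB W1 (LANDED, p101028): self-similar covariance of the full hard-sphere Euler system. -/
theorem stub_selfSimilarCovariance : SelfSimilarCovariance :=
  Theorems.R2OneModeTwoConditions.stub_selfSimilarCovariance

/-- STUB W4 (LANDED, p106459): radial reduction of the self-similar system with a general equation of state. -/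
theorem stub_radialReduction : ∀ (r : ℝ) (D H Z : ℝ → ℝ) (pf w tf : ℝ × ℝ → ℝ) (z : ℝ × V3), z.2 ≠ 0 → DifferentiableAt ℝ pf (logPt z) → DifferentiableAt ℝ w (logPt z) → DifferentiableAt ℝ tf (logPt z) → 0 < pf (logPt z) → DifferentiableAt ℝ D z.1 → DifferentiableAt ℝ Z (pf (logPt z) * D z.1 ^ 3) → (SelfSimEulerZAt r D H Z (radDensity pf) (radTemperature tf) (radVelocity w) z ↔ (dτ pf (logPt z) = (w (logPt z) - 1) * dx pf (logPt z) + pf (logPt z) * (dx w (logPt z) + 3 * w (logPt z) + 3 - 3 * r) ∧ dτ w (logPt z) = (w (logPt z) - 1) * dx w (logPt z) + w (logPt z) ^ 2 - r * w (logPt z) + (2 * tf (logPt z) + tf (logPt z) * dx pf (logPt z) / pf (logPt z) + dx tf (logPt z)) * Z (pf (logPt z) * D z.1 ^ 3) + tf (logPt z) * deriv Z (pf (logPt z) * D z.1 ^ 3) * (dx pf (logPt z) * D z.1 ^ 3) ∧ dτ tf (logPt z) = (w (logPt z) - 1) * dx tf (logPt z) + 2 / 3 * Z (pf (logPt z) *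 D z.1 ^ 3) * tf (logPt z) * dx w (logPt z) + tf (logPt z) * (2 * w (logPt z) - 2 * r + 2 * w (logPt z) * Z (pf (logPt z) * D z.1 ^ 3)) + H z.1 * (Z (pf (logPt z) * D z.1 ^ 3) - 1) * tf (logPt z))) :=
  Theorems.R2OneModeTwoConditions.stub_radialReduction

/-- The corrected radial reduction `RadialReductionD` holds (v7 bookkeeping). -/
theorem radialReductionD : RadialReductionD :=
  stub_radialReduction

/-- STUB W2 (LANDED, p105814): isentropic ideal radial reduction; its linearisation is `(linW, linS)`. -/
theorem stub_isentropicReduction : IsentropicReduction :=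
  Theorems.R2OneModeTwoConditions.stub_isentropicReduction

/-- STUB (LANDED, p106649, kidder line): straight-cone locality for the full athermal system, every smooth law `ζ`. -/
theorem stub_coneLocality : Theorems.KidderKnobMelnikov.HsEulerConeLocality :=
  Theorems.KidderKnobMelnikov.stub_coneLocality

/-- STUB P (CERTIFIED-NUMERICS INPUT, ∃-form, NEW in v8, strip clause v8c, size XL; OPEN — replaces the ∀-form `stub_spectralPackage`):
THE `(1, 2)` SPECTRAL PACKAGE WITH NEUTRAL STRIP (`OneModeTwoConditionsStrip`, §0a) OF ONE PROFILE IN THE BCG WINDOW. There is a globally smooth monatomic profile `(r, W, S)` with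
`11/10 < r < 227/200`, its two profile equations in original form, and `OneModeTwoConditions r W S`: unique genuine unstable
smooth radial mode `Λ₁ ∈ (6(r−1), 9(r−1))`, algebraically simple, no other smooth radial point spectrum in `Re Λ > 0` besides the
gauge mode `Λ = r`. Numerics on record (five codes + c3-0's strip scan `SpectrumC3.md`): `r₂ = 1.11281614862801…`,
`Λ₁ = 0.79711291…`, strip `−0.2865 < Re Λ < 0.797` holds only the symmetry mode `0`; nearest stable smooth mode `−0.3172`.
Proof plan: (i) the profile = `stub_profileEqs stub_bcgProfile` (PROVED) — but PINNED: re-run the landed shooting proof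
(`thm11_monatomic_of_leftData'`) on a window `[r_lo, r_hi] ∋ r₂` of width `≤ 10⁻⁶` (two high-precision right-barrier
certificates in the engine of `CompressibleEulerImplosionRightD/RightU`; the 32 left windows already cover it), which also
records that the profile is the SLOW analytic branch at `P₂`; (ii) the CERTIFIED COUNT uniformly on that window: smooth-mode ⇔
zero of the Evans function of the analytic-branch matching problem (local Frobenius theory at the centre and at the sonic
regular-singular point), existence and simplicity of `Λ₁` by a validated enclosure, exclusion elsewhere in `Re Λ > 0` by the
argument principle on a bounded contour plus the resolvent/dissipativity bound that confines smooth point spectrum with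
`Re Λ > −δ` to a compact set (Merle–Raphaël–Rodnianski–Szeftel 2022 §3 structure: maximal dissipativity + finite rank in
`H^k_w`). Sources: BuckmasterCaolaboraGomezserrano2025 Thm 1.1 + App. B, Biasi2021 §3, MerleEtAl2022 §3, SpectrumC3.md. -/
theorem stub_profilePackage :
    ∃ (r : ℝ) (W S : ℝ → ℝ), (11 / 10 < r ∧ r < 227 / 200) ∧ IsMonatomicProfile r W S ∧
      (∀ x, (W x - 1) * deriv W x + 3 * S x * deriv S x = r * W x - W x ^ 2 - 3 * S x ^ 2 ∧
        (1 - W x) * deriv S x - S x / 3 * deriv W x = S x * (2 * W x - r)) ∧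
      OneModeTwoConditionsStrip r W S := by
  sorry

/-- STUB L1 (NEW in v8, size M) — LANDED (p123856, `Theorems.R2OneModeTwoConditions.stub_chartReading`), wired v8b: CHART READING of classical hard-sphere solutions below the EOS threshold
(`HsChartReading`, §0d). The `σ > 0` twin of the landed `memberCore_chart_solves` (`…MemberCoreChart.lean`: `contDiffOn_chart`,
`athermalEulerAt_chart` at `ζ ≡ 1`): same chart calculus (`torusFDeriv_chart`, `torusGradient_chart`,
`torusPartialDeriv_chart`), the primitive equations `hsEuler_density_eq / velocity_eq / temperature_eq`
(`…PolynomialCompressionUniquenessPrimitive.lean`), and the pressure FIELD identity `hsPressure σ ρ θ = ρ θ Z(ρσ³)` near every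
point of packing `< η₀` (`Theorems.R2OneModeTwoConditions.pressureField_eq`). -/
theorem stub_chartReading : HsChartReading :=
  Theorems.R2OneModeTwoConditions.stub_chartReading

/-- STUB L2 (NEW in v8, size S–M) — LANDED (p123957, `Theorems.R2OneModeTwoConditions.stub_rotationCovariance`), wired v8b: ROTATION COVARIANCE of the chart system (`ChartRotationCovariance`, §0d).
Mathlib: `ContinuousLinearEquiv.comp_right_fderiv`, `LinearIsometryEquiv` preserves inner products (so
`gradient (f ∘ Q) x = Q.symm (gradient f (Q x))`), the trace `∑ᵢ ⟪Q⁻¹ A Q eᵢ, eᵢ⟫ = ∑ᵢ ⟪A eᵢ, eᵢ⟫` for the divergence, and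
injectivity of `Q.symm` for the momentum equation. -/
theorem stub_rotationCovariance : ChartRotationCovariance :=
  Theorems.R2OneModeTwoConditions.stub_rotationCovariance

/-- STUB L3 (NEW in v8, size M–L) — LANDED (p124057, `Theorems.R2OneModeTwoConditions.stub_shrinkingBallLocality`), wired v8b: SHRINKING-BALL LOCALITY (`ShrinkingBallLocality`, §0d) from the landed straight-cone
`Theorems.KidderKnobMelnikov.stub_coneLocality` (`HsEulerConeLocality`): restart the straight-cone statement on the pieces of a
partition `0 = t₀ < … < t_n = t` with the constant speeds `c_k = max_{[t_k, t_{k+1}]} c` (time-shifted fields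
`(s, x) ↦ Pᵢ (t_k + s) x` are again `C¹` on the shifted slab and solve the pointwise system; agreement at `t_k` on the open
ball of radius `R − Σ_{j<k} c_j Δt_j` passes to the next piece by continuity from the left), and let the mesh go to `0`
(upper Riemann sums of the continuous `c` converge to `∫₀ᵗ c`). -/
theorem stub_shrinkingBallLocality : ShrinkingBallLocality :=
  Theorems.R2OneModeTwoConditions.stub_shrinkingBallLocality

/-- STUB L4 (NEW in v8, size L) — LANDED (p124201, `Theorems.R2OneModeTwoConditions.stub_exteriorAgreement`), wired v8b: EXTERIOR AGREEMENT on the torus (`ExteriorAgreement`, §0d). Plan: `η₁` = half the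
analyticity threshold of `hsEosLowDensity_proof`, small enough that the athermal sound speed satisfies
`c_s² = θ(ζ + Pζ′) + (2/3)θζ² ≤ 2θ` at packing `< η₁` and `ζ + Pζ′ > 0` (hyperbolicity); smooth `Z` from
`exists_smooth_compressibility_Icc`; read both solutions in the chart at `x₀` (`stub_chartReading`'s content, or re-derived);
continuity induction on `t* = sup {t | agreement off the fattened ball on [0, t]}`: at `t*` the second solution equals the first
off the ball, so by uniform continuity on a compact time slab its density stays in the hyperbolicity range a little longer on
slightly smaller exterior sets; apply `HsEulerConeLocality` (speed bound needed for the FIRST triple only) on small straight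
cones around exterior points, time-shifted to start at `t*`; cones compose (radius loss `c Δt`), contradiction unless
`t* = t₁`. Chart safety: all cones lie in `‖y‖ < 1/4 + …` of ONE chart since `R₀ + c t₁ < 1/4` — exterior points far from
`x₀` are handled in their own charts (data agree on whole chart balls there). -/
theorem stub_exteriorAgreement : ExteriorAgreement :=
  Theorems.R2OneModeTwoConditions.stub_exteriorAgreement

/-- STUB M1 (NEW in v8d, size M) — LANDED (p124524, `Theorems.R2OneModeTwoConditions.stub_scalingMode`), wired v8e: the scaling symmetry mode as a typed smooth radial mode (`ScalingMode`, §0e). -/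
theorem stub_scalingMode : ScalingMode :=
  Theorems.R2OneModeTwoConditions.stub_scalingMode

/-- STUB M2 (NEW in v8d, size S–M) — LANDED (p124596, `Theorems.R2OneModeTwoConditions.stub_slavingODE`), wired v8f: the slaving lemma above the resonance (`SlavingODE`, §0e). -/
theorem stub_slavingODE : SlavingODE :=
  Theorems.R2OneModeTwoConditions.stub_slavingODE

/-- STUB M3 (NEW in v8d, size S) — LANDED (p124445, `Theorems.R2OneModeTwoConditions.stub_entropyTransportZ`), wired v8e: exact entropy transport for a general athermal law at jet level (`EntropyTransportZ`, §0e). -/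
theorem stub_entropyTransportZ : EntropyTransportZ :=
  Theorems.R2OneModeTwoConditions.stub_entropyTransportZ

/-- STUB M4 (NEW in v8e, size L) — LANDED (p124862, `Theorems.R2OneModeTwoConditions.stub_exteriorDevelopment`), wired v8g: the exterior development exists up to any `T₂ < T₁` uniformly in σ (`ExteriorDevelopment`, §0f),
assembled from the sibling crux's `stub_logBudgetShadowing` + `stub_conditionalExistence` + `hsEosLowDensity_proof`. -/
theorem stub_exteriorDevelopment : ExteriorDevelopment :=
  Theorems.R2OneModeTwoConditions.stub_exteriorDevelopment

/-- STUB H (THE HEART, size XL, RESHAPED v8/v8d, held by the lead; OPEN): TUNED FORCED THRESHOLD TRACKING. Given the four locality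
bricks of §0d (chart reading, rotation covariance, shrinking-ball locality, exterior agreement — stubs L1–L4, all LANDED) and the three
bricks of §0e (scaling mode, slaving lemma, entropy transport — stubs M1–M3), a globally
smooth monatomic profile in the BCG window with its original-form equations and the `(1, 2)` package forces `TunedPacking`
(landed, = the flow-free crux). Architecture (lead c3-0 `NOTES-c3.md` §Heart + lead c4-0 NOTES): in the self-similar
variables of `stub_selfSimilarCovariance` / `RadialReductionD` ADJOIN the packing scale `ε = c σ³ e^{μτ}` (`ε′ = με`,
`μ = 3(r−1)`): the forced hard-sphere system becomes AUTONOMOUS in `(X, ε)` with the fixed point `(SS, 0)`, unstable rates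
`{Λ₁, μ}` plus the gauge `r` and the neutral scaling mode (modulation); `σ` enters only through the initial point
`(D(σ; q, b, β), ε₀ = cσ³)`. (A) DATA: exact `SS` seed on the core chart ball (kidder `KnobFamily`, landed), Kidder knob `b`
(`ProjectiveCovariance`), stable-type bump `β`, unstable shape `q`; pinned density `rhoLim = a₀/∫a₀ + σ³h₁ + σ⁶h₂ + O(σ⁹)` in
`C^k` (`TiedStatics`, `secondOrder_rate`). (B) EXISTENCE by continuation: `stub_conditionalExistence` (sibling crux, landed)
from a-priori `C¹` bounds of EVERY solution with the data on `[0, t_η]` — exterior bounds by `ExteriorAgreement` against the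
exterior development `τ^σ` (exists on `[0, T_loc)` uniformly in `σ`, `T_loc > T` for small blow-up time `T`:
`hsEulerWellPosedness` (i)), core bounds by the bootstrap (C)–(D) run on the solution read in the chart at `x₀`
(`HsChartReading`), radial there by `ChartRotationCovariance` + `ShrinkingBallLocality` with the bootstrap's speed bound
`≲ (T−t)^{1/r−1}`, hence a solution of `RadialReductionD`. (C) LINEAR THEORY in `H^k_w` around `SS`: dissipativity at high
`k` from certified repulsivity inequalities of the profile, finite-rank remainder, spectral projections; the package gives the
count in `Re Λ > 0`. (D) FORCED BOOTSTRAP on `[τ₀, τ_η]` with Brouwer in the unstable coordinate: threshold `q_thr(σ; b, β)`,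
window `∝ σ^{3Λ₁/μ} = σ^{7.07}`; `η` chosen small so the slaved response `O(ε³)` and the exit-end Duhamel term
`O(ε_η^{3−Λ₁/μ} ε₀^{Λ₁/μ})` fit the window. (E) EXPANSION `q_thr = q₀ + ε₀K₁ + ε₀²K₂ + O(ε₀³)` (orders `< Λ₁/μ ∈ (2,3)` must
vanish). (F) COMMON ZERO of `(K₁, K₂)` on knob × direction from certified signs + continuity: `K₁(·,0)` cubic in
`λ* = 1 + bT` with transversal root `b₀T = −0.4234` (three codes), `G₂ = −K₂/∂_bK₁` along `{K₁ = 0} ∩ W^s` from `+0.0905`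
(β = 0) through `0` at `β ≈ 13.8 %` to `−0.015` (16 %) along the sonic density bump (c2-0, third code). Why it might fail:
the sign change of `K₂` along `{K₁ = 0}` does not survive certification at `SS(r₂)` (then `SS(r₄)`, `J = 4`). Leans on (all
PROVED in tree): `HsEosLowDensity`, `HsEulerWellPosedness`, `stub_conditionalExistence`, `LagrangeIdentity`, `ExactSelfSimilar`,
`SelfSimilarCovariance`, `RadialReductionD`, `IsentropicReduction`, `ProjectiveCovariance`, `TiedStatics`, `KidderKnob`,
`HsEulerConeLocality`, `MemberCore`, the BCG profile theorem, `tunedPacking_iff_denseExcursion`. Sources: CaolaboraEtAl2025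
arXiv:2310.05325 Thm 1.2, MerleEtAl2022, BuckmasterCaolaboraGomezserrano2025, Biasi2021, Kidder1974, Majda1984, Dafermos2005
Thm 5.2.1. -/
theorem stub_tunedForcedImplosion :
    HsChartReading → ChartRotationCovariance → ShrinkingBallLocality → ExteriorAgreement →
    ScalingMode → SlavingODE → EntropyTransportZ → ExteriorDevelopment →
    ∀ (r : ℝ) (W S : ℝ → ℝ), 11 / 10 < r → r < 227 / 200 → IsMonatomicProfile r W S →
      (∀ x, (W x - 1) * deriv W x + 3 * S x * deriv S x = r * W x - W x ^ 2 - 3 * S x ^ 2 ∧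
        (1 - W x) * deriv S x - S x / 3 * deriv W x = S x * (2 * W x - r)) →
      OneModeTwoConditionsStrip r W S → TunedPacking := by
  sorry

/-! ### §2 Composition (kernel-checked, no stub inside, NO hypothesis): the stubs give the crux BY NAME -/

/-- `DenseExcursion` from the stubs, unconditionally: one pinned profile with its `(1,2)` package (`stub_profilePackage`, OPEN),
the four locality bricks (`stub_chartReading`, `stub_rotationCovariance`, `stub_shrinkingBallLocality`,
`stub_exteriorAgreement`, OPEN — workers), the tuned forced implosion (`stub_tunedForcedImplosion`, OPEN — the heart) and the
landed flow-free form of the crux (`tunedPacking_iff_denseExcursion`). -/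
theorem DenseExcursion_of : DenseExcursion := by
  obtain ⟨r, W, S, ⟨hr₁, hr₂⟩, hprof, heqs, hpkg⟩ := stub_profilePackage
  exact tunedPacking_iff_denseExcursion.mp
    (stub_tunedForcedImplosion stub_chartReading stub_rotationCovariance stub_shrinkingBallLocality
      stub_exteriorAgreement stub_scalingMode stub_slavingODE stub_entropyTransportZ stub_exteriorDevelopment
      r W S hr₁ hr₂ hprof heqs hpkg)

end Summit.AtomisticToContinuum.HydrodynamicLimit.Cruxes.DenseExcursion.R2OneModeTwoConditions

end
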